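import Summits.QuantumFields.BalabanUV.T4Continuum.Support.NE9Lemma1RemainderSpeciesEnd
import Summits.QuantumFields.BalabanUV.T4Continuum.Support.NE9CPieceCouplingModulus
import Summits.QuantumFields.BalabanUV.T4Continuum.Support.NE9MarginalFreeClass

/-!
# NE9RemainderSpeciesMargProj — the MARGINAL-PROJECTION leaf (row MP, `hPinto`) DISCHARGED AT THE DISPLAYED SPECIES: the
# species' analytic class is closed under the read-out projection, `ProjInto Adm MF (margProj r A)` holds for the marginal-free
# part of the analytic class, and the END-M read-out face `…_margProj` for `𝒯 := cpieceChannel D.toC` follows BY NAME with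
# S-sum, S5 AND MP discharged — in two forms: leaf A3 from displayed per-piece responses (§3) or displayed as `hTcup` (§4, the
# `…_margProj` twin of the owner's part 3) (cell `pub-balaban`, T4-DAG §2 node U3 / §6 NE9; NE9 formalisation swarm, unit
# `b2b-balaban-t4-ne9-formalise-leaf-04` gen 5 — lineage item «MP-REM», journal CLAIM l.9052; the owner g24's closing line
# l.9120 names «the `…_margProj` twin of part 3 (RO/AW/MP by name)» as the next kernel item of the row)

HONEST FRAMING (T4-DAG PAGE 1).  Rung (B)+1 of the FINITE-VOLUME T⁴ programme — NOT infinite volume, NOT a mass gap, NOT the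
Clay problem.  NE9 (`T4OutputRate.NE9` ∧ `FadingMemory`) is a cell NEW ESTIMATE, NOT PRINTED, NOT discharged here; spine 0/9;
0/18 skeleton leaves instantiated on Bałaban's objects (O-NE9-1).  HONEST DEPENDENCY (cell line, verbatim): continuum YM on T⁴
⇐ BetaPertH ∧ nine spine estimates (0/9 proved); BetaPertH ⇐ (D1) ∧ (D4) ∧ CAP+tail; G-an2-4 gates asym, D1 and NE2/3/4.
`FlowStep.BetaPertH`, (B), (B^μ) do not occur.  [I] = [Balaban1987RG1] (CMP **109**), [II] = [Balaban1988RG2Cluster]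
(CMP **116**) are quoted for TYPES only (ABSOLUTE RULE: nothing printed in the audited series is asserted).

WHERE THIS SITS.  Skeleton v1.3.x reads the history channel on the PROJECTED old terms, `T := 𝒯 ∘ margProj r A`
(`margProj r A H U X = H U X − r_{scale X}(H↾scale X)·A U X`: the scale-by-scale package `{−β_{j+1}(g_j)A^η + 𝐄^{(j+1)}}` of
[I] (1.3) p. 260 / (1.6) p. 261, the recipe (1.20)–(1.22) p. 264 re-attached), and the END-M face
`NE9MarginalProjectionEnd.…_margProj` displays the projection binder **`hPinto : ProjInto Adm MF (margProj r A)`** (row MP).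
Lineage gen 3 (`NE9MarginalFreeClass`, p210502) proved it at the ABSTRACT read-out level for `MF := {H ∈ S | ∀ j, r_j(H↾j) = 0}`
from additivity + ray-homogeneity + ONE normalisation number.  Meanwhile the row OWNER typed the DISPLAYED species of [II] §1 as a
class-relative piece form on the ANALYTIC class (`NE9Lemma1RemainderSpecies`, p212850: `RemData`, `D.toC`, `analyticClass D.R`,
`pieceBoundOnG_rem` PROVED) and leaf-09-g4 moved the END-M read-out face onto the class-relative form
(`NE9CPieceCouplingModulus.…_margProj_cpieceForm`, p212551, `hPinto`/`hPiece`/`hP0`/`hloc`/`hsrc` displayed).  THIS FILE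
closes the MP socket AT THE SPECIES:
* §1 the analytic class is CLOSED under real multiples, scale-wise multiples of a direction, and the read-out projection
  (`margProj_mem_analyticClass` — the coefficient `r_{scale X}(H↾scale X)` is background-free and `lift` is ℝ-linear);
  `pieceBoundOnG_mono` (the owner's per-piece binder is antitone in the class).
* §2 **`projInto_margProj_analytic`**: `ProjInto Adm {H | H ∈ analyticClass R ∧ H ∈ S ∧ ∀ j, r_j(H↾j) = 0} (margProj r A)` from
  `Adm ⊆ analyticClass R` (S1-type: the terms are analytic, [I] (1.18) p. 263 — TYPE), `A ∈ analyticClass R` + the scale-wise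
  multiples of `A` in `Adm` (AW-type, [I] (1.11)–(1.14) p. 262 — TYPE; the SAME `hAmul` binder p212551 displays), the read-out's
  additivity on `Adm`, ℝ-homogeneity on the marginal ray and the NORMALISATION `r_j(A↾j) = 1 ∨ r_j ≡ 0 on Adm↾j` (O1's number —
  GAPS C-ne9leaf03g2-1 INFO 2), and the closure `∀ H ∈ Adm, margProj r A H ∈ S` of the further structure `S` of the marginal-free
  class (gauge invariance, vacuum subtraction — O1): gen-3's `projInto_margProj_of_readAdditive` BY NAME, the analytic part of
  the target PROVED by §1.
* §3 **`termSize_ne9_and_fadingMemory_rem_margProj_cpieceForm`**: p212551's END-M face APPLIED BY NAME at `P := D.toC`, `MF :=`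
  the set of §2, `Kp := KpOf D c_dir`, `gain := ℓ⁵`, with `hP0`/`hloc`/`hsrc` := `pieceZero_rem`/`pieceLocal_rem`/`csrcScale_rem`,
  `hPiece` := `pieceBoundOnG_rem` restricted to MF, **`hPinto` := §2**, `hadd`/`haddMF` := the ONE displayed additivity binder
  `PieceAdditiveOn (analyticClass D.R) D.toC` (crew row (w16)) restricted to `Adm`/`MF`.  Conclusion LITERALLY END-M's.
* §4 **`termSize_ne9_and_fadingMemory_rem_margProj`**: the `…_margProj` TWIN of the owner's part 3
  (`NE9Lemma1RemainderSpeciesEnd.termSize_ne9_and_fadingMemory_rem_compProj`, p213009) — part 3 APPLIED BY NAME at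
  `P := margProj r A`, `MF :=` the set of §2, `c := cr·aA`, its four projection binders supplied by `projAdditive_margProj` /
  `projScaleComm_margProj` / **§2** / `projSize_margProj` (END-M's own route from `…_compProj` to `…_margProj`), `hMF` by
  construction; leaf A3 stays displayed as `hTcup` (as in part 3).  Conclusion LITERALLY END-M `…_margProj`'s with `τbar := c_Q`.
DISPLAYED on these faces (honest list): O1-type data (`RemData`, the carriers, `r`, `A`, `S`, `Ψ`, `act`, `ρ`, …), the species'
`RemData.Admissible` + `LevelCountsG` (owner), `Adm ⊆ analyticClass`, AW (`DirSize A κ aA`, `A ∈ analyticClass`, `hAmul`), RO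
(`hrA hr0 hrs` + `hcoef` + `hnorm`), `hS`, (w16), the species' per-piece coupling responses `hrespE`/`hrespA` at `D.toC` (leaf A3
— producer: A3-REM, journal l.9031), and END-M's A1/A2/R/G/N binders VERBATIM.  GONE versus p212551 §4: `hP0 hloc hsrc hPiece
hPinto hadd haddMF hKp hgain`.  DISGUISE TEST: one input family, one read-out, one marginal direction, set algebra of classes +
the END applied by name — no history comparison is proved here; not NE9.

WHAT IS PROVED (kernel, `[folklore]` bookkeeping; 12 theorems, 0 `def`, 0 sorry): §1 `lift_smul`, `lift_scaleMul`, `lift_margProj`,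
`scaleMul_const`, `smul_mem_analyticClass`, `scaleMul_mem_analyticClass`, **`margProj_mem_analyticClass`**, `pieceBoundOnG_mono`;
§2 **`projInto_margProj_analytic`**, `margFree_subset_analyticClass`; §3 **`termSize_ne9_and_fadingMemory_rem_margProj_cpieceForm`**;
§4 **`termSize_ne9_and_fadingMemory_rem_margProj`**.

References (TYPES only): [Balaban1987RG1] T. Bałaban, *Renormalization group approach to lattice gauge field theories. I*,
Commun. Math. Phys. **109** (1987) 249–301 — (0.28)–(0.30) p. 258, (1.3) p. 260, (1.6) p. 261, (1.11)–(1.14) p. 262, (1.18)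
p. 263, (1.20)–(1.22) p. 264; [Balaban1988RG2Cluster] T. Bałaban, *… II. Cluster expansions*, Commun. Math. Phys. **116**
(1988) 1–22 — (1.23)–(1.29) pp. 7–8, (1.33)–(1.36) p. 9.  Summits-side NEW work (LEAN PLACEMENT RULE); imports p213009 (hence
p212277/p212850) + p212551 + p210502 BY NAME; modifies nothing; 0 sorry; 0 `def`.  Value = the MP binder removed from the displayed list of the
species' END-M read-out face (modulo O1's normalisation number and the read-out's ray-homogeneity), NOT summit progress.
-/

noncomputable section

namespace Summit.QuantumFields.BalabanUV.T4Continuum.NE9RemainderSpeciesMargProj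

open scoped BigOperators
open Metric Set
open Literature.MathematicalPhysics.QuantumFieldTheory.Balaban1983to89
open Literature.MathematicalPhysics.QuantumFieldTheory.Balaban1983to89.T4OutputRate
open Literature.MathematicalPhysics.QuantumFieldTheory.Balaban1983to89.T4HistoryLipschitzRecursion
open Literature.MathematicalPhysics.QuantumFieldTheory.Balaban1983to89.T4HistoryLipschitzOuter
open Literature.MathematicalPhysics.QuantumFieldTheory.Balaban1983to89.T4HistoryLipschitzActivity
open Literature.MathematicalPhysics.QuantumFieldTheory.Balaban1983to89.T4HistoryLipschitzActivity (ClusterGeom)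
open Literature.MathematicalPhysics.QuantumFieldTheory.Balaban1983to89.T4HistoryLipschitzSegment
open Summit.QuantumFields.BalabanUV.T4Continuum.NE9Lemma1Counting
open Summit.QuantumFields.BalabanUV.T4Continuum.NE9Lemma1Gain
open Summit.QuantumFields.BalabanUV.T4Continuum.NE9Lemma1PieceClass
open Summit.QuantumFields.BalabanUV.T4Continuum.NE9Lemma1RemainderSpecies
open Summit.QuantumFields.BalabanUV.T4Continuum.NE9Lemma1RemainderSpeciesEnd
open Summit.QuantumFields.BalabanUV.T4Continuum.NE9ComplexEncoding (doubleCarriers)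
open Summit.QuantumFields.BalabanUV.T4Continuum.NE9LastCouplingBridge
open Summit.QuantumFields.BalabanUV.T4Continuum.NE9BridgeSizeInduction
open Summit.QuantumFields.BalabanUV.T4Continuum.NE9MarginalProjection
open Summit.QuantumFields.BalabanUV.T4Continuum.NE9MarginalProjectionEnd
open Summit.QuantumFields.BalabanUV.T4Continuum.NE9MarginalFreeClass (projInto_margProj_of_readAdditive)
open Summit.QuantumFields.BalabanUV.T4Continuum.NE9CPieceCouplingModulus

variable {C : Carriers} {E : Type}

/-! ## §1 The analytic class is closed under the read-out projection; the per-piece binder is antitone -/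

section Closure

/-- The lift of a real multiple is the (real) multiple of the lift. [folklore] -/
theorem lift_smul (c : ℝ) (H : E → (doubleCarriers C).Dom → ℝ) (X : C.Dom) :
    lift (c • H) X = fun U => (c : ℂ) • lift H X U := by
  funext U; apply Complex.ext <;> simp [lift]

/-- The lift of a scale-wise multiple `U X ↦ c(scale X)·A U X` of a direction: at the domain `X` both copies carry the SAME
coefficient `c(scale X)`, so the lift is that real multiple of the lift of `A`. [folklore] -/
theorem lift_scaleMul (c : ℕ → ℝ) (A : E → (doubleCarriers C).Dom → ℝ) (X : C.Dom) :
    lift (fun U X' => c ((doubleCarriers C).scale X') * A U X') X = fun U => (c (C.scale X) : ℂ) • lift A X U := by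
  funext U; apply Complex.ext <;> simp [lift, doubleCarriers]

/-- The lift of the projected family: `lift (margProj r A H) X = lift H X − r_{scale X}(H↾scale X) • lift A X` — the read-out
coefficient is BACKGROUND-FREE and common to the two copies of `X`. [cite: Balaban1987RG1, (1.3) p.260 and (1.20)-(1.22) p.264] -/
theorem lift_margProj (r : ℕ → (E → (doubleCarriers C).Dom → ℝ) → ℝ) (A H : E → (doubleCarriers C).Dom → ℝ) (X : C.Dom) :
    lift (margProj r A H) X =
      fun U => lift H X U - (r (C.scale X) (restrictScale (C.scale X) H) : ℂ) • lift A X U := by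
  funext U; apply Complex.ext <;> simp [lift, margProj, doubleCarriers]

/-- A scale-wise multiple with a CONSTANT coefficient is the real multiple. [folklore] -/
theorem scaleMul_const (c : ℝ) (A : E → (doubleCarriers C).Dom → ℝ) :
    (fun U X' => (fun _ : ℕ => c) ((doubleCarriers C).scale X') * A U X') = c • A := by
  funext U X'; simp [Pi.smul_apply, smul_eq_mul]

variable [NormedAddCommGroup E] [NormedSpace ℂ E]

/-- The analytic class is closed under real multiples. [folklore] -/
theorem smul_mem_analyticClass {R : C.Dom → ℝ} {H : E → (doubleCarriers C).Dom → ℝ} (hH : H ∈ analyticClass R) (c : ℝ) :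
    c • H ∈ analyticClass R := by
  intro X
  rw [lift_smul]
  exact (hH X).const_smul (c : ℂ)

/-- The analytic class contains the scale-wise multiples of an analytic direction (the shape of p212551's `hAmul` binder, for
`Adm := analyticClass R`). [folklore] -/
theorem scaleMul_mem_analyticClass {R : C.Dom → ℝ} {A : E → (doubleCarriers C).Dom → ℝ} (hA : A ∈ analyticClass R)
    (c : ℕ → ℝ) : (fun U X' => c ((doubleCarriers C).scale X') * A U X') ∈ analyticClass R := by
  intro X
  rw [lift_scaleMul]
  exact (hA X).const_smul (c (C.scale X) : ℂ)

/-- **THE ANALYTIC CLASS IS CLOSED UNDER THE READ-OUT PROJECTION**: for an analytic family `H` and an analytic marginal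
direction `A`, `margProj r A H` is analytic (whatever the read-out `r`: its coefficients do not depend on the background).
[cite: Balaban1987RG1, (1.3) p.260, (1.18) p.263 and (1.20)-(1.22) p.264] -/
theorem margProj_mem_analyticClass {R : C.Dom → ℝ} (r : ℕ → (E → (doubleCarriers C).Dom → ℝ) → ℝ)
    {A H : E → (doubleCarriers C).Dom → ℝ} (hA : A ∈ analyticClass R) (hH : H ∈ analyticClass R) :
    margProj r A H ∈ analyticClass R := by
  intro X
  rw [lift_margProj]
  exact (hH X).sub ((hA X).const_smul ((r (C.scale X) (restrictScale (C.scale X) H) : ℝ) : ℂ))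

end Closure

section Mono

variable {C' : Carriers} {Bg ι α β γ : Type}

/-- The owner's per-piece binder `PieceBoundOnG` is ANTITONE in the class. [folklore] -/
theorem pieceBoundOnG_mono {Adm Adm' : Set (Bg → C'.Dom → ℝ)} (hsub : Adm' ⊆ Adm) {P : CPieceData C' Bg ι α β γ}
    {κ κ₁ d0 : ℝ} {Kp : ℕ → ι → ℝ} {gain : ℕ → ℕ → ℝ} (h : PieceBoundOnG Adm P κ κ₁ d0 Kp gain) :
    PieceBoundOnG Adm' P κ κ₁ d0 Kp gain :=
  fun k s y a ha b hb j x hx H hH N hN hbd => h k s y a ha b hb j x hx H (hsub hH) N hN hbd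

end Mono

/-! ## §2 Leaf MP at the species: `ProjInto` for the marginal-free part of the analytic class -/

section ProjInto

variable [NormedAddCommGroup E] [NormedSpace ℂ E]

/-- **LEAF MP AT THE DISPLAYED SPECIES (kernel).**  For an admissible class of ANALYTIC families (`Adm ⊆ analyticClass R` —
[I] (1.18) p. 263: the terms are *"defined and analytic on the space U^c_j(X, α₀, α₁)"*, TYPE), an ANALYTIC marginal direction
whose scale-wise multiples are admissible (AW-type, [I] (1.11)–(1.14) p. 262, TYPE), a read-out ADDITIVE on `Adm` and
ℝ-HOMOGENEOUS on the marginal ray with the NORMALISATION `r_j(A↾j) = 1` (or `r_j ≡ 0` on `Adm↾j` at unread scales — O1's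
number), and a structural class `S` receiving the projections (the further structure of the marginal-free class — gauge
invariance [I] (1.19) p. 263, vacuum subtraction; O1), the read-out projection maps `Adm` INTO the marginal-free part
of the analytic class `{H | H ∈ analyticClass R ∧ H ∈ S ∧ ∀ j, r_j(H↾j) = 0}` — gen-3's `projInto_margProj_of_readAdditive`
with the analytic clause of the target PROVED (§1).  Conclusion: LITERALLY the END-M binder `hPinto` at this `MF`.
[cite: Balaban1987RG1, (0.28)-(0.29) p.258, (1.3) p.260, (1.18)-(1.19) p.263, (1.20)-(1.22) p.264] -/
theorem projInto_margProj_analytic {R : C.Dom → ℝ} {Adm S : Set (E → (doubleCarriers C).Dom → ℝ)}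
    {r : ℕ → (E → (doubleCarriers C).Dom → ℝ) → ℝ} {A : E → (doubleCarriers C).Dom → ℝ}
    (hAdmAn : Adm ⊆ analyticClass R) (hAan : A ∈ analyticClass R)
    (hAmul : ∀ c : ℕ → ℝ, (fun U X' => c ((doubleCarriers C).scale X') * A U X') ∈ Adm)
    (hrA : ReadAdditive Adm r)
    (hcoef : ∀ (j : ℕ) (c : ℝ), r j (restrictScale j (c • A)) = c * r j (restrictScale j A))
    (hnorm : ∀ j : ℕ, r j (restrictScale j A) = 1 ∨ ∀ H ∈ Adm, r j (restrictScale j H) = 0)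
    (hS : ∀ H ∈ Adm, margProj r A H ∈ S) :
    ProjInto Adm {H | H ∈ analyticClass R ∧ H ∈ S ∧ ∀ j, r j (restrictScale j H) = 0} (margProj r A) := by
  have hray : ∀ c : ℝ, c • A ∈ Adm := fun c => by rw [← scaleMul_const c A]; exact hAmul fun _ => c
  have h := projInto_margProj_of_readAdditive (S := analyticClass R ∩ S)
    (fun H hH => ⟨margProj_mem_analyticClass r hAan (hAdmAn hH), hS H hH⟩) hrA hray hcoef hnorm
  intro H hH
  exact ⟨(h H hH).1.1, (h H hH).1.2, (h H hH).2⟩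

/-- The marginal-free part of the analytic class IS a sub-class of the analytic class (the owner's part-3 binder `hMF`, here by
construction). [folklore] -/
theorem margFree_subset_analyticClass (R : C.Dom → ℝ) (S : Set (E → (doubleCarriers C).Dom → ℝ))
    (r : ℕ → (E → (doubleCarriers C).Dom → ℝ) → ℝ) :
    {H | H ∈ analyticClass R ∧ H ∈ S ∧ ∀ j, r j (restrictScale j H) = 0} ⊆ analyticClass (E := E) R :=
  fun _ h => h.1

end ProjInto

/-! ## §3 The END-M read-out face at the displayed species, MP / S-sum / S5 discharged -/

section EndFace

variable {C₀ : Carriers} [NormedAddCommGroup E] [NormedSpace ℂ E] {ι α β γ δ : Type} [DecidableEq δ]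
variable (G : ClusterGeom (doubleCarriers C₀)) {Pot : Type*} [NormedAddCommGroup Pot] [NormedSpace ℂ Pot]

/-- **NE9 ∧ FADING MEMORY ∧ TERM SIZE ON THE v1.3 DICTIONARY AT THE DISPLAYED SPECIES — rows MP, S-sum, S5 DISCHARGED (kernel
end-to-end).**  leaf-09-g4's END-M face at form level `…_margProj_cpieceForm` (p212551) APPLIED BY NAME at `P := D.toC` (the
displayed species of [II] §1, `NE9Lemma1RemainderSpecies`), the marginal-free class `MF := {H | H ∈ analyticClass D.R ∧ H ∈ S ∧
∀ j, r_j(H↾j) = 0}`, `Kp := KpOf D c_dir`, `gain := ℓ⁵`, with: `PieceZero`/`PieceLocal`/`CSrcScale` := `pieceZero_rem`/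
`pieceLocal_rem`/`csrcScale_rem`; S5's `PieceBoundOnG MF D.toC …` := the owner's `pieceBoundOnG_rem` (PROVED on the analytic
class) restricted to `MF`; **MP's `ProjInto Adm MF (margProj r A)` := §2**; the additivity binders on `Adm` and on `MF` := the ONE
displayed `PieceAdditiveOn (analyticClass D.R) D.toC` (crew row (w16)) restricted.  DISPLAYED: the species' `RemData.Admissible`
(domain inclusion (I.3.36)–(3.53), radii, G1 — TYPE) and `LevelCountsG` ((1.26)–(1.28)); `Adm ⊆ analyticClass D.R`; AW (`DirSize`,
`A ∈ analyticClass`, `hAmul`); RO (`hrA hr0 hrs`, ray-homogeneity `hcoef`, normalisation `hnorm`); the S-closure `hS`; the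
species' per-piece coupling responses `hrespE`/`hrespA` (leaf A3); and every other END-M binder VERBATIM.  Conclusion = END-M's
with `τbar := c_Q`, `qTbar := (qc + cr·Nbar·qcA)·c_Q·(1−ω)⁻¹`.  Nothing of [I]–[II] asserted; NE9 NOT PROVED; 0/9 unchanged.
[cite: Balaban1987RG1, (0.28)-(0.30) p.258, (1.3) p.260, (1.18) p.263, (1.20)-(1.22) p.264; Balaban1988RG2Cluster, (1.23)-(1.29) pp.7-8, (1.33)-(1.36) p.9] -/
theorem termSize_ne9_and_fadingMemory_rem_margProj_cpieceForm
    {D : RemData C₀ E ι α β γ δ} {ℓg : ℕ → ℕ → ℝ} {cdir d0 : ℝ}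
    {Ef : Functional (doubleCarriers C₀) E} {W : Set (ℕ → ℝ)} {Adm S : Set (E → (doubleCarriers C₀).Dom → ℝ)}
    {r : ℕ → (E → (doubleCarriers C₀).Dom → ℝ) → ℝ} {A : E → (doubleCarriers C₀).Dom → ℝ}
    {Ψ : ℕ → ℝ → (ι → ℝ) → E → (doubleCarriers C₀).Dom → ℝ} {act : ℕ → ℝ → E → Pot → G.P → ℂ} {𝒜 : ℕ → Set Pot}
    {n : ℕ → ℝ → E → G.P → ℝ} {lip clip : ℕ → ℝ} {a d : G.P → ℝ} {δv : (doubleCarriers C₀).Dom → ℝ}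
    {κ O1 cQ ω qc qcA Nbar B lipbar clipbar cr aA : ℝ} {p₀ N : ℕ → ℝ}
    (ρ : ℕ → (ι → ℝ) → Pot) (U₀ : E) (explZ : ℕ → E → (doubleCarriers C₀).Dom → ℝ) (h0 : ScaleZeroFree Ef W)
    (hAdm : AdmissibleTerms Ef W Adm) (hres : AdmRestrict Adm)
    -- the species' binders (printed TYPE + numerals) and the analyticity of the admissible terms
    (hD : D.Admissible ℓg cdir d0) (hℓg : ∀ k j, 0 ≤ ℓg k j)
    (hL : LevelCountsG D.toC.frame κ D.κ₁ O1 cQ (fun k j => ℓg k j ^ 5) (agePow ω))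
    (hAdmAn : Adm ⊆ analyticClass D.R)
    -- crew row (w16): additivity of the (1.23)-pieces in the old term on the analytic class (displayed)
    (hA16 : PieceAdditiveOn (analyticClass D.R) D.toC)
    -- the read-out and the marginal direction (END-M's RO / AW binders, verbatim) …
    (hrA : ReadAdditive Adm r) (hr0 : ReadZero r) (hrs : ReadSize Adm r κ cr) (hA : DirSize A κ aA) (hcr : 0 ≤ cr)
    (haA : 0 ≤ aA)
    -- … and what MP needs of them at the species: analyticity of `A`, its scale-wise multiples admissible (p212551's `hAmul`),
    -- ray-homogeneity and NORMALISATION of the read-out, the closure of the structural class `S` under the projection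
    (hAan : A ∈ analyticClass D.R)
    (hAmul : ∀ c : ℕ → ℝ, (fun U X' => c ((doubleCarriers C₀).scale X') * A U X') ∈ Adm)
    (hcoef : ∀ (j : ℕ) (c : ℝ), r j (restrictScale j (c • A)) = c * r j (restrictScale j A))
    (hnorm : ∀ j : ℕ, r j (restrictScale j A) = 1 ∨ ∀ H ∈ Adm, r j (restrictScale j H) = 0)
    (hS : ∀ H ∈ Adm, margProj r A H ∈ S)
    -- leaf A3 at the species: the per-piece coupling responses of the terms and of the multiples of `A` (displayed)
    (hrespE : ∀ g ∈ W, ∀ g' ∈ W, ∀ (k : ℕ) (y : ι), ∀ a' ∈ D.toC.S0 k y, ∀ b ∈ D.toC.SY k y a', ∀ (j : ℕ),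
      ∀ x ∈ D.toC.src k y a' j,
      |D.toC.piece k g y a' b x (Ef g) - D.toC.piece k g' y a' b x (Ef g)| ≤
        KpOf D cdir k y * qc * ℓg k j ^ 5 * Real.exp (-(κ * (doubleCarriers C₀).d x)) *
          Real.exp (-(1 / 8) * (D.κ₁ - 1) * D.toC.dY k y + (1 / 8) * D.κ₁ * d0 - (1 / 2) * (D.κ₁ - 1) * D.toC.vol k y a' b) *
            |g k - g' k|)
    (hrespA : ∀ g ∈ W, ∀ g' ∈ W, ∀ (k : ℕ) (y : ι), ∀ a' ∈ D.toC.S0 k y, ∀ b ∈ D.toC.SY k y a', ∀ (j : ℕ),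
      ∀ x ∈ D.toC.src k y a' j, ∀ c : ℕ → ℝ,
      |D.toC.piece k g y a' b x (fun U X => c ((doubleCarriers C₀).scale X) * A U X) -
          D.toC.piece k g' y a' b x (fun U X => c ((doubleCarriers C₀).scale X) * A U X)| ≤
        |c ((doubleCarriers C₀).scale x)| * (KpOf D cdir k y * qcA * ℓg k j ^ 5 * Real.exp (-(κ * (doubleCarriers C₀).d x)) *
          Real.exp (-(1 / 8) * (D.κ₁ - 1) * D.toC.dY k y + (1 / 8) * D.κ₁ * d0 - (1 / 2) * (D.κ₁ - 1) * D.toC.vol k y a' b) *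
            |g k - g' k|))
    (hqc : 0 ≤ qc) (hqcA : 0 ≤ qcA) (hO1 : 0 ≤ O1) (hcQ : 0 ≤ cQ) (hω0 : 0 ≤ ω) (hω1 : ω < 1) (hNb : ∀ j, N j ≤ Nbar)
    -- END-M's remaining binders at `T := cpieceChannel D.toC ∘ margProj r A`, verbatim
    (hfac : Factorises Ef W (compProj (cpieceChannel D.toC) (margProj r A)) Ψ) (hclip0 : ∀ k, 0 ≤ clip k)
    (hCup : ∀ g ∈ W, ∀ g' ∈ W, ∀ (k : ℕ) (U : E) (X : (doubleCarriers C₀).Dom), (doubleCarriers C₀).scale X = k + 1 →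
      ∀ Q ∈ 𝒜 k, ∀ γ' ∈ G.vol X,
      ‖act k (g k) U Q γ'‖ ≤ n k (g' k) U γ' ∧
        ‖act k (g k) U Q γ' - act k (g' k) U Q γ'‖ ≤ clip k * |g k - g' k| * n k (g' k) U γ')
    (hreprV : ∀ (k : ℕ) (s : ℝ) (Q : ι → ℝ) (U : E) (X : (doubleCarriers C₀).Dom),
      Ψ k s Q U X = (G.newTerm act k s U X (ρ k Q)).re - (G.newTerm act k s U₀ X (ρ k Q)).re + explZ k U X)
    (hclipb : ∀ k, clip k ≤ clipbar)
    (hK : TwoPointKP G W act 𝒜 n lip a d) (hdec : G.DecayExtract δv d) (hpin : G.PinBudget a δv (fun _ => B) κ)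
    (hρ : ∀ (k : ℕ) (Q Q' : ι → ℝ) (M : ℝ),
      (∀ y, |Q y - Q' y| ≤ weightOf D.toC.frame D.κ₁ d0 O1 (KpOf D cdir) k y * M) → ‖ρ k Q - ρ k Q'‖ ≤ M)
    (hexplZ : ∀ (k : ℕ) (U : E) (X : (doubleCarriers C₀).Dom), (doubleCarriers C₀).scale X = k + 1 →
      |explZ k U X| ≤ Real.exp (-(κ * (doubleCarriers C₀).d X)) * p₀ k)
    (hbase : ∀ g ∈ W, ∀ (U : E) (X : (doubleCarriers C₀).Dom), (doubleCarriers C₀).scale X = 0 →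
      |Ef g U X| ≤ Real.exp (-(κ * (doubleCarriers C₀).d X)) * N 0)
    (hNsucc : ∀ j, p₀ j + 2 * B ≤ N (j + 1)) (hNnn : ∀ j, 0 ≤ N j)
    (hbox : ∀ (k : ℕ) (Q : ι → ℝ),
      (∀ y, |Q y| ≤ weightOf D.toC.frame D.κ₁ d0 O1 (KpOf D cdir) k y *
        sizeRadius (fun k j => (1 + cr * aA) * tauOfG cQ (agePow ω) k j) N k) → ρ k Q ∈ 𝒜 k)
    (hB : 0 ≤ B) (hlipb : ∀ k, lip k ≤ lipbar) (hpos : 0 < ω + 8 * lipbar * B * ((1 + cr * aA) * cQ)) :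
    TermSize Ef W κ N ∧
      NE9 Ef W κ (prodModuli (8 * clipbar * B + 8 * lipbar * B * ((qc + cr * Nbar * qcA) * cQ * (1 - ω)⁻¹))
        fun _ => ω + 8 * lipbar * B * ((1 + cr * aA) * cQ)) ∧
        FadingMemory ((8 * clipbar * B + 8 * lipbar * B * ((qc + cr * Nbar * qcA) * cQ * (1 - ω)⁻¹)) /
            (ω + 8 * lipbar * B * ((1 + cr * aA) * cQ)))
          (ω + 8 * lipbar * B * ((1 + cr * aA) * cQ))
          (prodModuli (8 * clipbar * B + 8 * lipbar * B * ((qc + cr * Nbar * qcA) * cQ * (1 - ω)⁻¹))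
            fun _ => ω + 8 * lipbar * B * ((1 + cr * aA) * cQ)) := by
  -- MP at the species (§2) and the class inclusion
  have hPinto : ProjInto Adm {H | H ∈ analyticClass D.R ∧ H ∈ S ∧ ∀ j, r j (restrictScale j H) = 0} (margProj r A) :=
    projInto_margProj_analytic hAdmAn hAan hAmul hrA hcoef hnorm hS
  have hMF := margFree_subset_analyticClass (E := E) D.R S r
  -- S5 on MF from the owner's PROVED per-piece bound on the analytic class; additivity restricted from (w16)
  have hPiece : PieceBoundOnG {H | H ∈ analyticClass D.R ∧ H ∈ S ∧ ∀ j, r j (restrictScale j H) = 0} D.toC κ D.κ₁ d0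
      (KpOf D cdir) (fun k j => ℓg k j ^ 5) :=
    pieceBoundOnG_mono hMF (pieceBoundOnG_rem hD hℓg κ)
  have hadd : PieceAdditiveOn Adm D.toC := pieceAdditiveOn_mono hAdmAn hA16
  have haddMF : PieceAdditiveOn {H | H ∈ analyticClass D.R ∧ H ∈ S ∧ ∀ j, r j (restrictScale j H) = 0} D.toC :=
    pieceAdditiveOn_mono hMF hA16
  exact termSize_ne9_and_fadingMemory_of_couplingTwoPoint_vacSub_sizeInduction_margProj_cpieceForm G D.toC ρ U₀ explZ h0
    hAdm hres hrA hr0 hrs hA hcr haA hPinto (pieceZero_rem D) (pieceLocal_rem D) (csrcScale_rem hD) hadd haddMF hPiece hL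
    hAmul hrespE hrespA (kpOf_nonneg hD) hqc hqcA hO1 (fun k j => pow_nonneg (hℓg k j) 5) hcQ hω0 hω1 hNb hfac hclip0 hCup
    hreprV hclipb hK hdec hpin hρ hexplZ hbase hNsucc hNnn hbox hB hlipb hpos

/-- **THE `…_margProj` TWIN OF THE OWNER'S PART 3 AT THE DISPLAYED SPECIES — rows MP, S-sum, S5 DISCHARGED, A3 displayed as
`hTcup` (kernel end-to-end).**  The owner's `NE9Lemma1RemainderSpeciesEnd.termSize_ne9_and_fadingMemory_rem_compProj` (p213009)
APPLIED BY NAME at `P := margProj r A`, `MF := {H | H ∈ analyticClass D.R ∧ H ∈ S ∧ ∀ j, r_j(H↾j) = 0}`, `c := cr·aA`, with the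
four projection binders supplied: `ProjAdditive` := `projAdditive_margProj` (RO additivity), `ProjScaleComm` :=
`projScaleComm_margProj` (`ReadZero`), **`ProjInto` := §2**, `ProjSize` := `projSize_margProj` (`ReadSize` + `DirSize`) — exactly
END-M's own derivation of `…_margProj` from `…_compProj`, now with MP discharged and `hMF` by construction.  DISPLAYED: as in part 3
(`RemData.Admissible`, `LevelCountsG`, (w16), `hTcup`, the face's A1/A2/R/G/N binders) with `hPadd hPcomm hPinto hPsize hc hMF`
REPLACED by RO (`hrA hr0 hrs` + `hcoef` + `hnorm`), AW (`hA haA`, `A ∈ analyticClass`, `hAmul`), `Adm ⊆ analyticClass`, `hS`.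
Conclusion LITERALLY END-M `…_margProj`'s with `τbar := c_Q`. Nothing of [I]–[II] asserted; NE9 NOT PROVED; 0/9 unchanged.
[cite: Balaban1987RG1, (0.28)-(0.30) p.258, (1.3) p.260, (1.18) p.263, (1.20)-(1.22) p.264; Balaban1988RG2Cluster, (1.23)-(1.29) pp.7-8, (1.33)-(1.36) p.9] -/
theorem termSize_ne9_and_fadingMemory_rem_margProj
    {D : RemData C₀ E ι α β γ δ} {ℓg : ℕ → ℕ → ℝ} {cdir d0 O1 cQ : ℝ}
    {Ef : Functional (doubleCarriers C₀) E} {W : Set (ℕ → ℝ)} {Adm S : Set (E → (doubleCarriers C₀).Dom → ℝ)}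
    {r : ℕ → (E → (doubleCarriers C₀).Dom → ℝ) → ℝ} {A : E → (doubleCarriers C₀).Dom → ℝ}
    {Ψ : ℕ → ℝ → (ι → ℝ) → E → (doubleCarriers C₀).Dom → ℝ} {act : ℕ → ℝ → E → Pot → G.P → ℂ} {𝒜 : ℕ → Set Pot}
    {n : ℕ → ℝ → E → G.P → ℝ} {lip clip : ℕ → ℝ} {a d : G.P → ℝ} {δv : (doubleCarriers C₀).Dom → ℝ}
    {κ B lipbar clipbar qTbar ω cr aA : ℝ} {qT p₀ N : ℕ → ℝ}
    -- the species' binders (printed TYPE + numerals) and the analyticity of the admissible terms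
    (hD : D.Admissible ℓg cdir d0) (hℓg : ∀ k j, 0 ≤ ℓg k j)
    (hL : LevelCountsG D.toC.frame κ D.κ₁ O1 cQ (fun k j => ℓg k j ^ 5) (agePow ω)) (hO1 : 0 ≤ O1) (hcQ : 0 ≤ cQ)
    (hAdmAn : Adm ⊆ analyticClass D.R)
    -- crew row (w16): additivity of the (1.23)-pieces in the old term on the analytic class (displayed; `pieceAdditiveOn_rem`)
    (hA16 : PieceAdditiveOn (analyticClass D.R) D.toC)
    -- the face's binders, verbatim …
    (ρ : ℕ → (ι → ℝ) → Pot) (U₀ : E) (explZ : ℕ → E → (doubleCarriers C₀).Dom → ℝ) (h0 : ScaleZeroFree Ef W)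
    (hAdm : AdmissibleTerms Ef W Adm) (hres : AdmRestrict Adm)
    -- … with END-M's RO / AW binders in place of the four projection binders …
    (hrA : ReadAdditive Adm r) (hr0 : ReadZero r) (hrs : ReadSize Adm r κ cr) (hA : DirSize A κ aA) (hcr : 0 ≤ cr)
    (haA : 0 ≤ aA)
    -- … and what MP needs at the species (§2)
    (hAan : A ∈ analyticClass D.R)
    (hAmul : ∀ c : ℕ → ℝ, (fun U X' => c ((doubleCarriers C₀).scale X') * A U X') ∈ Adm)
    (hcoef : ∀ (j : ℕ) (c : ℝ), r j (restrictScale j (c • A)) = c * r j (restrictScale j A))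
    (hnorm : ∀ j : ℕ, r j (restrictScale j A) = 1 ∨ ∀ H ∈ Adm, r j (restrictScale j H) = 0)
    (hS : ∀ H ∈ Adm, margProj r A H ∈ S)
    (hfac : Factorises Ef W (compProj (cpieceChannel D.toC) (margProj r A)) Ψ) (hclip0 : ∀ k, 0 ≤ clip k)
    (hCup : ∀ g ∈ W, ∀ g' ∈ W, ∀ (k : ℕ) (U : E) (X : (doubleCarriers C₀).Dom), (doubleCarriers C₀).scale X = k + 1 →
      ∀ Q ∈ 𝒜 k, ∀ γ' ∈ G.vol X,
      ‖act k (g k) U Q γ'‖ ≤ n k (g' k) U γ' ∧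
        ‖act k (g k) U Q γ' - act k (g' k) U Q γ'‖ ≤ clip k * |g k - g' k| * n k (g' k) U γ')
    (hqT0 : ∀ k, 0 ≤ qT k)
    (hTcup : ∀ g ∈ W, ∀ g' ∈ W, ∀ (k : ℕ) (y : ι),
      |compProj (cpieceChannel D.toC) (margProj r A) k g (Ef g) y -
          compProj (cpieceChannel D.toC) (margProj r A) k g' (Ef g) y| ≤
        weightOf D.toC.frame D.κ₁ d0 O1 (KpOf D cdir) k y * (qT k * |g k - g' k|))
    (hreprV : ∀ (k : ℕ) (s : ℝ) (Q : ι → ℝ) (U : E) (X : (doubleCarriers C₀).Dom),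
      Ψ k s Q U X = (G.newTerm act k s U X (ρ k Q)).re - (G.newTerm act k s U₀ X (ρ k Q)).re + explZ k U X)
    (hclipb : ∀ k, clip k ≤ clipbar) (hqTb : ∀ k, qT k ≤ qTbar)
    (hK : TwoPointKP G W act 𝒜 n lip a d) (hdec : G.DecayExtract δv d) (hpin : G.PinBudget a δv (fun _ => B) κ)
    (hρ : ∀ (k : ℕ) (Q Q' : ι → ℝ) (M : ℝ),
      (∀ y, |Q y - Q' y| ≤ weightOf D.toC.frame D.κ₁ d0 O1 (KpOf D cdir) k y * M) → ‖ρ k Q - ρ k Q'‖ ≤ M)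
    (hexplZ : ∀ (k : ℕ) (U : E) (X : (doubleCarriers C₀).Dom), (doubleCarriers C₀).scale X = k + 1 →
      |explZ k U X| ≤ Real.exp (-(κ * (doubleCarriers C₀).d X)) * p₀ k)
    (hbase : ∀ g ∈ W, ∀ (U : E) (X : (doubleCarriers C₀).Dom), (doubleCarriers C₀).scale X = 0 →
      |Ef g U X| ≤ Real.exp (-(κ * (doubleCarriers C₀).d X)) * N 0)
    (hNsucc : ∀ j, p₀ j + 2 * B ≤ N (j + 1)) (hNnn : ∀ j, 0 ≤ N j)
    (hbox : ∀ (k : ℕ) (Q : ι → ℝ), (∀ y, |Q y| ≤ weightOf D.toC.frame D.κ₁ d0 O1 (KpOf D cdir) k y *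
      sizeRadius (fun k j => (1 + cr * aA) * tauOfG cQ (agePow ω) k j) N k) → ρ k Q ∈ 𝒜 k)
    (hB : 0 ≤ B) (hlipb : ∀ k, lip k ≤ lipbar) (hω : 0 ≤ ω)
    (hpos : 0 < ω + 8 * lipbar * B * ((1 + cr * aA) * cQ)) :
    TermSize Ef W κ N ∧
      NE9 Ef W κ (prodModuli (8 * clipbar * B + 8 * lipbar * B * qTbar)
        fun _ => ω + 8 * lipbar * B * ((1 + cr * aA) * cQ)) ∧
        FadingMemory ((8 * clipbar * B + 8 * lipbar * B * qTbar) / (ω + 8 * lipbar * B * ((1 + cr * aA) * cQ)))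
          (ω + 8 * lipbar * B * ((1 + cr * aA) * cQ))
          (prodModuli (8 * clipbar * B + 8 * lipbar * B * qTbar) fun _ => ω + 8 * lipbar * B * ((1 + cr * aA) * cQ)) :=
  termSize_ne9_and_fadingMemory_rem_compProj G hD hℓg hL hO1 hcQ (margFree_subset_analyticClass (E := E) D.R S r) hA16 ρ U₀
    explZ h0 hAdm hres (projAdditive_margProj A hrA) (projScaleComm_margProj Adm A hr0)
    (projInto_margProj_analytic hAdmAn hAan hAmul hrA hcoef hnorm hS) (projSize_margProj hrs hA hcr) (mul_nonneg hcr haA)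
    hfac hclip0 hCup hqT0 hTcup hreprV hclipb hqTb hK hdec hpin hρ hexplZ hbase hNsucc hNnn hbox hB hlipb hω hpos

end EndFace

end Summit.QuantumFields.BalabanUV.T4Continuum.NE9RemainderSpeciesMargProj

end
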